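import Summits.CriticalPhenomena.PercolationContinuityZ3.Theorems.PercNearOneGluingNoHeavyLowerTailGZParallel
import HarnessLib

/-!
# `NoHeavyLowerTail` (stmt-CriticalPhenomena-4575) — support file: the EDGE-STEP CRITERION for the logarithmic
# covariance bound (delete / contract one non-hub edge)

Support file (`--supports stmt-CriticalPhenomena-4575`; closes nothing; no definitions, no named facts, no sorries),
prover `prim-ineq-prove-2` gen 14, memo `run/shared/lean/prim/prim-ineq-prove-2/THEOREM-W.md` §5(e) and MEMO-23 §0(3).

Setting (cell level, as in the `GZ*` files).  A hub network `G` and one non-hub edge `e` of weight `r`.  The six-cell law of `G` is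
the mixture of the laws of `G∖e` (edge closed, cells `·C`) and `G/e` (edge open = endpoints identified, cells `·M`): every cell
`X ∈ {w, θ, z, u, v}` (`w = P(ab|c)`, `θ = P(a↔b off c)`, `z = P(a↮c, b↮c)`, `u = P(a↮c)`, `v = P(b↮c)`) satisfies
`X = (1−r)·X_C + r·X_M`, and `Cov = z − uv`.  With `Φ := w log(θ/w) − Cov` (so `Φ ≥ 0` is the bound) the file proves the
**edge-step inequality**

  `Φ(G) − (1−r)·Φ(G∖e) ≥ r·[ w_M (log(θ/w) − 1) + w θ_M/θ − Cov_M − (1−r)(u_C − u_M)(v_C − v_M) ]`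

(`GZEdgeStep.edge_step`): the supergradient inequality of the concave function `(w, θ) ↦ w log(θ/w)` (`GZParallel.mul_log_div_le`,
i.e. `log y ≤ y − 1`) plus the polynomial identity `Cov − (1−r)Cov_C = r·Cov_M + r(1−r)(u_C−u_M)(v_C−v_M)`.  Consequently
(`edge_step_of_bracket`): if `G∖e` satisfies the bound and the bracket is `≥ 0`, then `G` satisfies the bound — the criterion by which
THEOREM W was proved (`GZWheatstone.wheatstone_cov_le_of_C4` is the instance `e = uv` of the Wheatstone bridge, where the bracket is
`p_a p_b (Λ − R′) ≥ 0` by `GZWheatstone.club`).  The bracket is NOT always nonnegative (memo MEMO-23 §0(3): the pendant blob edge of the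
ray-monotonicity counterexample), so this is a criterion, not a theorem about all edges.  [this work]
-/

namespace Summit.CriticalPhenomena.PercolationContinuityZ3.Theorems

namespace GZEdgeStep

/-- **Edge-step inequality.**  For one non-hub edge of weight `r ≤ 1` with the cells of `G`, `G∖e` (`·C`) and `G/e` (`·M`)
related affinely, `Φ(G) − (1−r)Φ(G∖e) ≥ r·[w_M(L−1) + wθ_M/θ − Cov_M − (1−r)(u_C−u_M)(v_C−v_M)]`, `L = log(θ/w)`.
Only `log y ≤ y − 1` (through `GZParallel.mul_log_div_le`) and ring identities are used. [this work] -/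
theorem edge_step {r w θ z u v wC θC zC uC vC wM θM zM uM vM : ℝ}
    (hr1 : r ≤ 1) (hw : 0 < w) (hθ : 0 < θ) (hwC : 0 < wC) (hθC : 0 < θC)
    (ew : w = (1 - r) * wC + r * wM) (eθ : θ = (1 - r) * θC + r * θM) (ez : z = (1 - r) * zC + r * zM)
    (eu : u = (1 - r) * uC + r * uM) (ev : v = (1 - r) * vC + r * vM) :
    r * (wM * (Real.log (θ / w) - 1) + w * θM / θ - (zM - uM * vM) - (1 - r) * ((uC - uM) * (vC - vM))) ≤
      (w * Real.log (θ / w) - (z - u * v)) - (1 - r) * (wC * Real.log (θC / wC) - (zC - uC * vC)) := by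
  have h1r : 0 ≤ 1 - r := by linarith
  -- supergradient inequality of w log(θ/w) at (w, θ), evaluated at (w_C, θ_C)
  have hsg : wC * Real.log (θC / wC) ≤ wC * Real.log (θ / w) + (θC * w / θ - wC) :=
    GZParallel.mul_log_div_le hwC hθC hθ hw
  set L := Real.log (θ / w) with hL
  -- the entropy side: w L − (1−r)(w_C L + θ_C w/θ − w_C) = r (w_M (L−1) + w θ_M/θ)
  have hA1 : (1 - r) * wC = w - r * wM := by rw [ew]; ring
  have hA2 : (1 - r) * θC = θ - r * θM := by rw [eθ]; ring
  have hθw : θ * (w / θ) = w := by field_simp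
  have stepA : w * L - (1 - r) * (wC * L + (θC * w / θ - wC)) = r * (wM * (L - 1) + w * θM / θ) := by
    have e : (1 - r) * (wC * L + (θC * w / θ - wC)) =
        ((1 - r) * wC) * L + ((1 - r) * θC) * (w / θ) - (1 - r) * wC := by ring
    rw [e, hA1, hA2]
    have e2 : w * θM / θ = θM * (w / θ) := by ring
    rw [e2]
    linear_combination (-1 : ℝ) * hθw
  -- the covariance side: Cov − (1−r)Cov_C = r Cov_M + r(1−r)(u_C−u_M)(v_C−v_M)
  have stepB : (z - u * v) - (1 - r) * (zC - uC * vC) = r * (zM - uM * vM) + r * ((1 - r) * ((uC - uM) * (vC - vM))) := by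
    rw [ez, eu, ev]; ring
  have h5 : 0 ≤ (1 - r) * ((wC * L + (θC * w / θ - wC)) - wC * Real.log (θC / wC)) :=
    mul_nonneg h1r (by linarith)
  have e5 : (1 - r) * ((wC * L + (θC * w / θ - wC)) - wC * Real.log (θC / wC)) =
      (1 - r) * (wC * L + (θC * w / θ - wC)) - (1 - r) * (wC * Real.log (θC / wC)) := by ring
  have e6 : r * (wM * (L - 1) + w * θM / θ - (zM - uM * vM) - (1 - r) * ((uC - uM) * (vC - vM))) =
      r * (wM * (L - 1) + w * θM / θ) - (r * (zM - uM * vM) + r * ((1 - r) * ((uC - uM) * (vC - vM)))) := by ring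
  linarith

/-- **Edge-step criterion**: if `G∖e` satisfies the logarithmic covariance bound and the bracket
`w_M(L−1) + wθ_M/θ − Cov_M − (1−r)(u_C−u_M)(v_C−v_M)` is nonnegative, then `G` satisfies the bound. [this work] -/
theorem edge_step_of_bracket {r w θ z u v wC θC zC uC vC wM θM zM uM vM : ℝ}
    (hr : 0 ≤ r) (hr1 : r ≤ 1) (hw : 0 < w) (hθ : 0 < θ) (hwC : 0 < wC) (hθC : 0 < θC)
    (ew : w = (1 - r) * wC + r * wM) (eθ : θ = (1 - r) * θC + r * θM) (ez : z = (1 - r) * zC + r * zM)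
    (eu : u = (1 - r) * uC + r * uM) (ev : v = (1 - r) * vC + r * vM)
    (hC : zC - uC * vC ≤ wC * Real.log (θC / wC))
    (hB : 0 ≤ wM * (Real.log (θ / w) - 1) + w * θM / θ - (zM - uM * vM) - (1 - r) * ((uC - uM) * (vC - vM))) :
    z - u * v ≤ w * Real.log (θ / w) := by
  have h := edge_step hr1 hw hθ hwC hθC ew eθ ez eu ev
  have h1 : 0 ≤ r * (wM * (Real.log (θ / w) - 1) + w * θM / θ - (zM - uM * vM) - (1 - r) * ((uC - uM) * (vC - vM))) :=
    mul_nonneg hr hB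
  have h2 : 0 ≤ (1 - r) * (wC * Real.log (θC / wC) - (zC - uC * vC)) := mul_nonneg (by linarith) (by linarith)
  linarith

end GZEdgeStep

end Summit.CriticalPhenomena.PercolationContinuityZ3.Theorems
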